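import Literature.Geometry.Lorentzian.KerrSchildLocalEnergy
import Literature.Geometry.Lorentzian.KerrDependenceWeights
import Literature.Geometry.Lorentzian.KerrWaveEnergy
import HarnessLib

/-!
# Crux `ChannelsResolveTameDevelopmentsR` (stmt-FinalStateConjecture-14075), line
# `trapped-set-observability-analyticity` — stub `stub_trappedSetObservability` (S4', reshaped):
# the FORWARD ENERGY BOUND on the flat member (slice energy does not grow forward)

Companion of `…TrappedSetForwardEnergy.lean` (p112090, forward UNIQUENESS on the flat member) and
`…TrappedSetBoxAtLapAt.lean` (p112586, `boxAt = lapAt = □_g`).  The wave-2 audit of the reshaped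
law `TwoSidedConcentrationLawK` isolates ONE cross-time quantity through which non-conservation
of energy can still cheat: the forward AMPLIFICATION `g = E₁[u](t)/E₁[u](s)` (`s ≤ t`) of an
entering parcel — a pure parcel-exchange superposition passes the three hypotheses iff
`g ≳ 1/(δK)`, so the law's `δ(K)` exists as soon as `g` is uniformly bounded on the member.  This
file proves the bound with the constant `1` on the FLAT MEMBER (`G ≡ η`, `r₀ < 0`, cylinder
`= E4`): for `u ∈ C²` with `□_η u = 0` (in the tree's divergence form
`KerrSchild.waveOperator minkowski.inverseMetric u = 0`, which is the line's
`boxAt (fun _ ↦ η) u = 0` by p112090's `stub_boxAtMinkowskiEqWaveOperator`) and `s ≤ t`,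
`sliceEnergy a r₀ u t ≤ sliceEnergy a r₀ u s` (unfolded, verbatim bodies).

* §1 `T^{00}[w] = ½ ∑_μ (∂_μ w)²` on the Minkowski background (`normalCurrent_minkowski_zero`);
* §2 `flat_ballEnergy_le`: Hawking–Ellis's Lemma 4.3.1 in the weighted form
  `KerrSchild.Background.weightedEnergy_le` (`KerrSchildLocalEnergy.lean`; Grönwall constant `0`,
  the coefficients being constant) with the cone weight of `KerrDependenceWeights.lean`
  (`= 1` on `{τ} × B(0,n)`, `≤ 1` everywhere, flux sign = dominant energy condition) gives
  `∫_{B(0,n)} ∑(∂v)²(τ) ≤ ∫ ∑(∂v)²(0)` for `τ ≥ 0`; `n → ∞` (`setLIntegral_iUnion_of_directed`)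
  gives `flat_energy_le`;
* §3 time translation to general `s ≤ t` in the line's (unfolded) vocabulary; §4 the registered
  sub-goal `stub_flatForwardEnergyBound`.
-/

set_option linter.dupNamespace false

noncomputable section

namespace Summit.FinalStateConjecture.FinalStateConjecture.Theorems.TrappedSet

open Literature.Geometry.Lorentzian
open scoped Manifold ContDiff Topology ENNReal NNReal BigOperators
open Filter Set Function TopologicalSpace MeasureTheory Metric

/-! ## §1 The `dt`-energy density of the Minkowski background is half the coordinate density -/

/-- On the Minkowski background `T^{00}[w] = ½ ∑_μ (∂_μ w)²`.
[cite: DafermosRodnianski2008, App. D] -/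
theorem normalCurrent_minkowski_zero (w : E4 → ℝ) (x : E4) :
    KerrSchild.normalCurrent KerrSchild.Background.minkowski.inverseMetric w x 0 =
      2⁻¹ * ∑ μ : Fin 4, (fderiv ℝ w x (E4.basisVector μ)) ^ 2 := by
  rw [KerrSchild.Background.normalCurrent_zero_eq]
  have hφ : KerrSchild.Background.minkowski.φ x = 0 := rfl
  simp only [KerrSchild.Background.inverseMetric_minkowski, Kerr.etaComp, Fin.sum_univ_four,
    Fin.isValue, hφ]
  simp only [show (0 : Fin 4) ≠ 1 from by decide, show (0 : Fin 4) ≠ 2 from by decide,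
    show (0 : Fin 4) ≠ 3 from by decide, if_true, if_false]
  ring

/-- The Minkowski coefficients are constant: `∂_μ η^{αβ} = 0`. [folklore] -/
theorem fderiv_inverseMetric_minkowski (x v : E4) (α β : Fin 4) :
    fderiv ℝ (fun y ↦ KerrSchild.Background.minkowski.inverseMetric y α β) x v = 0 := by
  simp [KerrSchild.Background.inverseMetric_minkowski]

/-! ## §2 The weighted energy estimate on solid cones of the flat background -/

/-- **Local forward energy bound for the flat wave equation.** For `v ∈ C²(ℝ⁴)` with
`∑_μ ∂_μ(η^{μν}∂_ν v) = 0` and `0 ≤ τ`, the coordinate energy of the slice `{x⁰ = τ}` inside the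
ball of radius `n` is at most the total coordinate energy of the slice `{x⁰ = 0}`:
`∫_{‖y‖ < n} ∑(∂v)²(τ,y) dy ≤ ∫ ∑(∂v)²(0,y) dy` — Hawking–Ellis's Lemma 4.3.1 in the weighted form
`KerrSchild.Background.weightedEnergy_le` (Grönwall constant `0`: the coefficients are constant)
with the cone weight `χ(2x⁰+2)·χ(R − x⁰ − (1 + ‖x⃗‖²)^{1/2})`, `R = n + τ + 2`, which is `1` on
`{τ} × B(0,n)` and `≤ 1` everywhere. [cite: HawkingEllis1973CUP, §4.3 Lemma 4.3.1] -/
theorem flat_ballEnergy_le {v : E4 → ℝ} (hv : ContDiff ℝ 2 v)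
    (hsol : ∀ x, KerrSchild.waveOperator KerrSchild.Background.minkowski.inverseMetric v x = 0)
    {τ : ℝ} (hτ : 0 ≤ τ) (n : ℕ) :
    (∫⁻ y in ball (0 : E3) n,
        ENNReal.ofReal (∑ μ : Fin 4, (fderiv ℝ v (E4.ofTimeSpace τ y) (E4.basisVector μ)) ^ 2)) ≤
      ∫⁻ y, ENNReal.ofReal
        (∑ μ : Fin 4, (fderiv ℝ v (E4.ofTimeSpace 0 y) (E4.basisVector μ)) ^ 2) := by
  set B := KerrSchild.Background.minkowski with hB
  set R : ℝ := n + τ + 2 with hR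
  -- ### the weight and its (compact) support
  set q₁ : E4 → ℝ := fun w ↦ R - w 0 - √((1 : ℝ) ^ 2 + ‖E4.spatial w - 0‖ ^ 2) with hq₁
  set W : E4 → ℝ := fun w ↦ Real.smoothTransition (2 * w 0 + 2) * Real.smoothTransition (q₁ w)
    with hW
  have hW1 : ContDiff ℝ 1 W := contDiff_slabTimeCutoff.mul
    (Real.smoothTransition.contDiff.comp (contDiff_coneArg one_ne_zero R 0))
  have hW0 : ∀ w, 0 ≤ W w := fun w ↦
    mul_nonneg (Real.smoothTransition.nonneg _) (Real.smoothTransition.nonneg _)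
  have hWle : ∀ w, W w ≤ 1 := fun w ↦
    mul_le_one₀ (Real.smoothTransition.le_one _) (Real.smoothTransition.nonneg _)
      (Real.smoothTransition.le_one _)
  have hWsupp : ∀ w, W w ≠ 0 → -1 < w 0 ∧ ‖E4.spatial w‖ < R - w 0 := by
    intro w hw
    obtain ⟨h1, h2⟩ := mul_ne_zero_iff.mp hw
    refine ⟨neg_one_lt_of_slabTimeCutoff_ne_zero h1, ?_⟩
    have hq : 0 < q₁ w := by
      by_contra hle
      exact h2 (Real.smoothTransition.zero_of_nonpos (not_lt.mp hle))
    have := norm_le_sqrt_sq_add_norm_sq 1 (E4.spatial w - 0)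
    rw [sub_zero] at this
    rw [hq₁] at hq
    dsimp only at hq
    rw [sub_zero] at hq
    linarith
  set K : Set E4 := (fun q : ℝ × E3 ↦ E4.ofTimeSpace q.1 q.2) ''
    (Set.Icc (-1) R ×ˢ closedBall (0 : E3) (R + 1)) with hK
  have hKc : IsCompact K :=
    (isCompact_Icc.prod (isCompact_closedBall 0 (R + 1))).image E4.continuous_ofTimeSpace_uncurry
  have hWK : ∀ w, W w ≠ 0 → w ∈ K := by
    intro w hw
    obtain ⟨h1, h2⟩ := hWsupp w hw
    have hn : 0 ≤ ‖E4.spatial w‖ := norm_nonneg _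
    refine ⟨(w 0, E4.spatial w), ⟨⟨h1.le, by linarith⟩, ?_⟩, E4.ofTimeSpace_time_spatial w⟩
    rw [mem_closedBall, dist_zero_right]
    linarith
  have hKρ : ∀ w ∈ K, E4.spatialNorm w ≤ R + 1 := by
    rintro w ⟨q, ⟨-, hq⟩, rfl⟩
    rw [E4.spatialNorm_ofTimeSpace]
    simpa [mem_closedBall, dist_zero_right] using hq
  -- ### the flux condition (dominant energy condition for the cone conormal)
  have hflux : ∀ w ∈ K, 0 ≤ w 0 → w 0 ≤ τ →
      ∑ μ, fderiv ℝ W w (E4.basisVector μ) *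
        KerrSchild.normalCurrent B.inverseMetric v w μ ≤ 0 := by
    intro w _ hw0 _
    set P : Fin 4 → ℝ := fun μ ↦ KerrSchild.normalCurrent B.inverseMetric v w μ with hP
    have hWev : W =ᶠ[𝓝 w] fun w' ↦
        Real.smoothTransition (q₁ w') * Real.smoothTransition ((fun _ : E4 ↦ (2 : ℝ)) w') := by
      filter_upwards [slabTimeCutoff_eventuallyEq_one (show -2⁻¹ < w 0 by linarith)]
        with w' hw'
      rw [hW]
      dsimp only
      rw [hw', one_mul, Real.smoothTransition.one_of_one_le (by norm_num : (1 : ℝ) ≤ 2),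
        mul_one]
    have hq₁d : DifferentiableAt ℝ q₁ w :=
      (coneArg_hasFDerivAt one_ne_zero R 0 w).differentiableAt
    refine sum_fderiv_smoothTransition_mul_le P hWev hq₁d (differentiableAt_const _) ?_
      (Or.inl (deriv_smoothTransition_eq_zero_of_one_lt one_lt_two))
    obtain ⟨hν0, hn⟩ := coneArg_covector one_ne_zero R 0 w
    have hc := B.coneCovector_causal w (fun μ ↦ -fderiv ℝ q₁ w (E4.basisVector μ)) hν0 hn
    have hpos := B.sum_mul_normalCurrent_nonneg v w
      (fun μ ↦ -fderiv ℝ q₁ w (E4.basisVector μ)) hc.1 hc.2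
    have hsum : ∑ μ, fderiv ℝ q₁ w (E4.basisVector μ) * P μ =
        -∑ μ, -fderiv ℝ q₁ w (E4.basisVector μ) *
          KerrSchild.normalCurrent B.inverseMetric v w μ := by
      rw [← Finset.sum_neg_distrib]
      exact Finset.sum_congr rfl fun μ _ ↦ by rw [hP]; ring
    rw [hsum]
    linarith
  -- ### the weighted energy estimate with Grönwall constant `0`
  have hle := B.weightedEnergy_le (U := Set.univ) hKc (Set.subset_univ K) (fun z _ ↦ hv.contDiffAt)
    hW1 hW0 hWK (fun w _ ↦ hsol w) hflux hKρ le_rfl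
    (fun w _ μ α β ↦ by rw [fderiv_inverseMetric_minkowski, abs_zero]) hτ le_rfl
  rw [mul_zero, zero_mul, Real.exp_zero, mul_one] at hle
  -- ### the densities: `P⁰ = ½ e`, continuity, integrability
  set e : E4 → ℝ := fun x ↦ ∑ μ : Fin 4, (fderiv ℝ v x (E4.basisVector μ)) ^ 2 with he
  have hP : ∀ x, KerrSchild.normalCurrent B.inverseMetric v x 0 = 2⁻¹ * e x :=
    normalCurrent_minkowski_zero v
  simp_rw [hP] at hle
  have he0 : ∀ x, 0 ≤ e x := fun x ↦ Finset.sum_nonneg fun μ _ ↦ sq_nonneg _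
  have hec : Continuous e := continuous_finsetSum _ fun μ _ ↦
    ((hv.continuous_fderiv (by norm_num)).clm_apply continuous_const).pow 2
  have hWc : Continuous W := hW1.continuous
  have hslice : ∀ t : ℝ, Continuous fun y : E3 ↦ e (E4.ofTimeSpace t y) := fun t ↦
    hec.comp (E4.continuous_ofTimeSpace t)
  have hWslice : ∀ t : ℝ, Continuous fun y : E3 ↦ W (E4.ofTimeSpace t y) := fun t ↦
    hWc.comp (E4.continuous_ofTimeSpace t)
  set ρ : ℝ := R + 1 with hρ
  have hint : ∀ t : ℝ, IntegrableOn
      (fun y : E3 ↦ W (E4.ofTimeSpace t y) * (2⁻¹ * e (E4.ofTimeSpace t y)))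
      (closedBall (0 : E3) ρ) := fun t ↦
    ((hWslice t).mul (continuous_const.mul (hslice t))).continuousOn.integrableOn_compact
      (isCompact_closedBall 0 ρ)
  have hint0 : IntegrableOn (fun y : E3 ↦ 2⁻¹ * e (E4.ofTimeSpace 0 y)) (closedBall (0 : E3) ρ) :=
    (continuous_const.mul (hslice 0)).continuousOn.integrableOn_compact (isCompact_closedBall 0 ρ)
  -- ### at time `0`: drop the weight
  have h0 : (∫ y in closedBall (0 : E3) ρ,
      W (E4.ofTimeSpace 0 y) * (2⁻¹ * e (E4.ofTimeSpace 0 y))) ≤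
        ∫ y in closedBall (0 : E3) ρ, 2⁻¹ * e (E4.ofTimeSpace 0 y) :=
    setIntegral_mono_on (hint 0) hint0 measurableSet_closedBall fun y _ ↦ by
      have := hWle (E4.ofTimeSpace 0 y)
      have := he0 (E4.ofTimeSpace 0 y)
      nlinarith
  -- ### at time `τ`: the weight is `1` on the ball of radius `n`
  have hWτ : ∀ y ∈ ball (0 : E3) n, W (E4.ofTimeSpace τ y) = 1 := by
    intro y hy
    rw [mem_ball, dist_zero_right] at hy
    rw [hW]
    dsimp only
    rw [E4.ofTimeSpace_apply_zero, Real.smoothTransition.one_of_one_le (by linarith), one_mul]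
    refine Real.smoothTransition.one_of_one_le ?_
    rw [hq₁]
    dsimp only
    rw [E4.ofTimeSpace_apply_zero, E4.spatial_ofTimeSpace, sub_zero]
    have hs : √((1 : ℝ) ^ 2 + ‖y‖ ^ 2) ≤ 1 + ‖y‖ := by
      rw [Real.sqrt_le_left (by positivity)]
      nlinarith [norm_nonneg y]
    rw [hR]
    linarith
  have hballρ : ball (0 : E3) n ⊆ closedBall (0 : E3) ρ := by
    refine ball_subset_closedBall.trans (closedBall_subset_closedBall ?_)
    rw [hρ, hR]; linarith
  -- ### assemble in `[0, ∞]`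
  have h2 : ENNReal.ofReal 2⁻¹ ≠ 0 := by simp
  have h2' : ENNReal.ofReal 2⁻¹ ≠ ⊤ := ENNReal.ofReal_ne_top
  have hhalf : ∀ x, ENNReal.ofReal (2⁻¹ * e x) = ENNReal.ofReal 2⁻¹ * ENNReal.ofReal (e x) :=
    fun x ↦ ENNReal.ofReal_mul (by norm_num)
  calc (∫⁻ y in ball (0 : E3) n, ENNReal.ofReal (e (E4.ofTimeSpace τ y)))
      = (ENNReal.ofReal 2⁻¹)⁻¹ * ∫⁻ y in ball (0 : E3) n,
          ENNReal.ofReal (W (E4.ofTimeSpace τ y) * (2⁻¹ * e (E4.ofTimeSpace τ y))) := by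
        rw [← lintegral_const_mul' _ _ (ENNReal.inv_ne_top.mpr h2)]
        refine setLIntegral_congr_fun measurableSet_ball fun y hy ↦ ?_
        rw [hWτ y hy, one_mul, hhalf, ← mul_assoc, ENNReal.inv_mul_cancel h2 h2', one_mul]
    _ ≤ (ENNReal.ofReal 2⁻¹)⁻¹ * ∫⁻ y in closedBall (0 : E3) ρ,
          ENNReal.ofReal (W (E4.ofTimeSpace τ y) * (2⁻¹ * e (E4.ofTimeSpace τ y))) :=
        mul_le_mul_right (lintegral_mono_set hballρ) _
    _ = (ENNReal.ofReal 2⁻¹)⁻¹ * ENNReal.ofReal (∫ y in closedBall (0 : E3) ρ,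
          W (E4.ofTimeSpace τ y) * (2⁻¹ * e (E4.ofTimeSpace τ y))) := by
        rw [ofReal_integral_eq_lintegral_ofReal (hint τ)
          (Eventually.of_forall fun y ↦ mul_nonneg (hW0 _) (mul_nonneg (by norm_num) (he0 _)))]
    _ ≤ (ENNReal.ofReal 2⁻¹)⁻¹ * ENNReal.ofReal (∫ y in closedBall (0 : E3) ρ,
          2⁻¹ * e (E4.ofTimeSpace 0 y)) :=
        mul_le_mul_right (ENNReal.ofReal_le_ofReal (hle.trans h0)) _
    _ = (ENNReal.ofReal 2⁻¹)⁻¹ * ∫⁻ y in closedBall (0 : E3) ρ,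
          ENNReal.ofReal (2⁻¹ * e (E4.ofTimeSpace 0 y)) := by
        rw [ofReal_integral_eq_lintegral_ofReal hint0
          (Eventually.of_forall fun y ↦ mul_nonneg (by norm_num) (he0 _))]
    _ = ∫⁻ y in closedBall (0 : E3) ρ, ENNReal.ofReal (e (E4.ofTimeSpace 0 y)) := by
        rw [← lintegral_const_mul' _ _ (ENNReal.inv_ne_top.mpr h2)]
        refine lintegral_congr fun y ↦ ?_
        rw [hhalf, ← mul_assoc, ENNReal.inv_mul_cancel h2 h2', one_mul]
    _ ≤ ∫⁻ y, ENNReal.ofReal (e (E4.ofTimeSpace 0 y)) := setLIntegral_le_lintegral _ _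

/-- **Forward energy bound for the flat wave equation**: the total coordinate energy of the slice
`{x⁰ = τ}`, `τ ≥ 0`, is at most that of `{x⁰ = 0}` (let `n → ∞` in `flat_ballEnergy_le`).
[cite: HawkingEllis1973CUP, §4.3 Lemma 4.3.1] -/
theorem flat_energy_le {v : E4 → ℝ} (hv : ContDiff ℝ 2 v)
    (hsol : ∀ x, KerrSchild.waveOperator KerrSchild.Background.minkowski.inverseMetric v x = 0)
    {τ : ℝ} (hτ : 0 ≤ τ) :
    (∫⁻ y, ENNReal.ofReal
        (∑ μ : Fin 4, (fderiv ℝ v (E4.ofTimeSpace τ y) (E4.basisVector μ)) ^ 2)) ≤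
      ∫⁻ y, ENNReal.ofReal
        (∑ μ : Fin 4, (fderiv ℝ v (E4.ofTimeSpace 0 y) (E4.basisVector μ)) ^ 2) := by
  have hmono : Monotone fun n : ℕ ↦ ball (0 : E3) (n : ℝ) := fun m n h ↦
    ball_subset_ball (by exact_mod_cast h)
  have hunion : (⋃ n : ℕ, ball (0 : E3) (n : ℝ)) = Set.univ := iUnion_ball_nat 0
  rw [← setLIntegral_univ, ← hunion, setLIntegral_iUnion_of_directed _ hmono.directed_le]
  exact iSup_le fun n ↦ flat_ballEnergy_le hv hsol hτ n


/-! ## §3 The forward energy bound on the flat member of the class, in the line's vocabulary -/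

/-- The flat divergence-form wave operator commutes with translations. [folklore] -/
theorem waveOperator_minkowski_comp_add_right (u : E4 → ℝ) (c z : E4) :
    KerrSchild.waveOperator KerrSchild.Background.minkowski.inverseMetric (fun y ↦ u (y + c)) z =
      KerrSchild.waveOperator KerrSchild.Background.minkowski.inverseMetric u (z + c) := by
  simp only [KerrSchild.waveOperator_apply, KerrSchild.Background.inverseMetric_minkowski]
  refine Finset.sum_congr rfl fun μ _ ↦ ?_
  set F : E4 → ℝ := fun y' ↦ ∑ ν, Kerr.etaComp μ ν * fderiv ℝ u y' (E4.basisVector ν) with hF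
  have h : (fun y ↦ ∑ ν, Kerr.etaComp μ ν * fderiv ℝ (fun y ↦ u (y + c)) y (E4.basisVector ν)) =
      fun y ↦ F (y + c) := by
    funext y
    simp only [hF, fderiv_comp_add_right]
  rw [h, fderiv_comp_add_right]

/-- **Forward energy bound on the flat member** (`G ≡ η`, `r₀ < 0`, cylinder `= E4`): for a `C²`
solution of the flat wave equation (hypothesis in the tree's divergence form
`KerrSchild.waveOperator minkowski.inverseMetric u = 0`, which IS the line's
`boxAt (fun _ ↦ η) u = 0` by the landed `stub_boxAtMinkowskiEqWaveOperator`, p112090) the line's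
slice energy does not grow forward: `sliceEnergy a r₀ u t ≤ sliceEnergy a r₀ u s` for `s ≤ t`
(unfolded, verbatim bodies of `sliceEnergy`, `eOne`, `cyl`) — the uniform forward amplification
bound with constant `1`, under which the `δ(K)`-choice of the energy-comparable concentration law
defeats every parcel-exchange superposition; in particular forward uniqueness.
[cite: HawkingEllis1973CUP, §4.3 Lemma 4.3.1] -/
theorem flat_sliceEnergy_le_forward (a : ℝ) {r₀ : ℝ} (hr₀ : r₀ < 0) {u : E4 → ℝ}
    (hu : ContDiffOn ℝ 2 u {x : E4 | r₀ < Kerr.radius a x})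
    (hsol : ∀ x ∈ {x : E4 | r₀ < Kerr.radius a x},
      KerrSchild.waveOperator KerrSchild.Background.minkowski.inverseMetric u x = 0)
    {s t : ℝ} (hst : s ≤ t) :
    (∫⁻ y in {y : E3 | E4.ofTimeSpace t y ∈ {x : E4 | r₀ < Kerr.radius a x}},
      ENNReal.ofReal
        (∑ μ : Fin 4, (fderiv ℝ u (E4.ofTimeSpace t y) (E4.basisVector μ)) ^ 2)) ≤
    (∫⁻ y in {y : E3 | E4.ofTimeSpace s y ∈ {x : E4 | r₀ < Kerr.radius a x}},
      ENNReal.ofReal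
        (∑ μ : Fin 4, (fderiv ℝ u (E4.ofTimeSpace s y) (E4.basisVector μ)) ^ 2)) := by
  have hcyl : {x : E4 | r₀ < Kerr.radius a x} = Set.univ :=
    Set.eq_univ_of_forall fun x ↦ hr₀.trans_le (Kerr.radius_nonneg a x)
  have hu' : ContDiff ℝ 2 u := by
    rw [hcyl] at hu
    exact contDiffOn_univ.mp hu
  simp only [hcyl, Set.mem_univ, Set.setOf_true, Measure.restrict_univ]
  -- the translate `v = u(· + s ∂₀)` (`(τ, y) + s ∂₀ = (τ + s, y)`)
  have key : ∀ (τ : ℝ) (y : E3),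
      E4.ofTimeSpace τ y + s • E4.basisVector 0 = E4.ofTimeSpace (τ + s) y := fun τ y ↦ by
    rw [E4.ofTimeSpace_eq_smul_add', E4.ofTimeSpace_eq_smul_add', add_smul]; abel
  set v : E4 → ℝ := fun z ↦ u (z + s • E4.basisVector 0) with hv
  have hvC : ContDiff ℝ 2 v := hu'.comp (contDiff_id.add contDiff_const)
  have hsolv : ∀ z,
      KerrSchild.waveOperator KerrSchild.Background.minkowski.inverseMetric v z = 0 := fun z ↦ by
    rw [hv, waveOperator_minkowski_comp_add_right]
    exact hsol _ (by rw [hcyl]; trivial)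
  have h := flat_energy_le hvC hsolv (τ := t - s) (sub_nonneg.mpr hst)
  have h1 : ∀ y : E3, fderiv ℝ v (E4.ofTimeSpace (t - s) y) = fderiv ℝ u (E4.ofTimeSpace t y) :=
    fun y ↦ by rw [hv, fderiv_comp_add_right, key, sub_add_cancel]
  have h2 : ∀ y : E3, fderiv ℝ v (E4.ofTimeSpace 0 y) = fderiv ℝ u (E4.ofTimeSpace s y) :=
    fun y ↦ by rw [hv, fderiv_comp_add_right, key, zero_add]
  simp only [h1, h2] at h
  exact h

/-! ## §4 The registered sub-goal of `stub_trappedSetObservability` (S4 v2) -/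

/-- Registered sub-goal `stub_flatForwardEnergyBound` of `stub_trappedSetObservability` (S4 v2) —
**the forward energy ESTIMATE on the flat member** (`r₀ < 0`, cylinder `= E4`, `G ≡ η`): for
every `C²` solution of the flat wave equation (divergence form; `= boxAt (fun _ ↦ η)` by p112090)
and `s ≤ t`, `sliceEnergy a r₀ u t ≤ sliceEnergy a r₀ u s` (vocabulary unfolded verbatim).
[cite: HawkingEllis1973CUP, §4.3 Lemma 4.3.1] -/
theorem stub_flatForwardEnergyBound :
    ∀ (a r₀ : ℝ), r₀ < 0 → ∀ u : E4 → ℝ, ContDiffOn ℝ 2 u {x : E4 | r₀ < Kerr.radius a x} → (∀ x ∈ {x : E4 | r₀ < Kerr.radius a x}, KerrSchild.waveOperator KerrSchild.Background.minkowski.inverseMetric u x = 0) → ∀ s t : ℝ, s ≤ t → (∫⁻ y in {y : E3 | E4.ofTimeSpace t y ∈ {x : E4 | r₀ < Kerr.radius a x}}, ENNReal.ofReal (∑ μ : Fin 4, (fderiv ℝ u (E4.ofTimeSpace t y) (E4.basisVector μ)) ^ 2)) ≤ (∫⁻ y in {y : E3 | E4.ofTimeSpace s y ∈ {x : E4 |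 r₀ < Kerr.radius a x}}, ENNReal.ofReal (∑ μ : Fin 4, (fderiv ℝ u (E4.ofTimeSpace s y) (E4.basisVector μ)) ^ 2)) :=
  fun a _ hr₀ _ hu hsol _ _ hst ↦ flat_sliceEnergy_le_forward a hr₀ hu hsol hst

end Summit.FinalStateConjecture.FinalStateConjecture.Theorems.TrappedSet

end
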